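import Summits.ResolutionOfSingularities.ResolutionOfSingularities.Theorems.FrobeniusClosingPatchingRelPerfectRoofEngine
import Literature.AlgebraicGeometry.Resolution.AlterationsDimension
import Mathlib.RingTheory.Ideal.Height
import HarnessLib

/-!
# Crux `PatchingPerfect` (stmt-ResolutionOfSingularities-16089), line `birth` v5:
# helpers for the engine over ONE regular base (stub `stub_regularBaseEngine`, E1)

Line `birth` v5 atomizes Zariski patching in ALL dimensions: Temkin's Noetherian induction is run
over one REGULAR base `B` (a regular `k`-variety) at a time, the step at a bad point being taken
at a point of the base which is MAXIMAL in the image of the bad locus; closed base points are fed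
by fibre-format atoms, NON-closed base points by Sing-format atoms at the regular local ring
`𝒪_{B,n}`, a `k`-algebra essentially of finite type whose residue field is NOT finite over `k`
and whose dimension is `< dim B`. This file proves the two facts about non-closed points used to
select the right atom:

* `not_isMaximal_primeIdealOf_of_not_isClosed` — on an affine chart `U ∋ n` of a scheme locally
  of finite type over a field, the prime of a NON-closed point `n` is not maximal (schemes locally
  of finite type over a field are Jacobson; closed points of an open are closed).
* `not_finite_residue_stalk_overHom_of_not_isClosed` — the residue field of `𝒪_{B,n}` at a
  non-closed point is NOT finite over `k` (else the domain `Γ(B, U)/𝔭 ⊆ κ(n)` would be finite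
  over `k`, hence a field, and `𝔭` maximal).
* `ringKrullDim_stalk_lt_of_not_isClosed` — `dim 𝒪_{B,n} < d` at a non-closed point of an
  integral `B` locally of finite type over `k` with `dim B ≤ d` (`dim 𝒪_{B,n} = ht 𝔭`,
  `ht 𝔭 + 1 ≤ ht 𝔪 ≤ dim Γ(B, U) = dim B` for a maximal `𝔪 ⊋ 𝔭`).

## Sources

* M. Temkin, Adv. Math. 219 (2008), proof of Prop. 2.3.4 (p. 12). [Temkin2008]
* The Stacks Project, Tags 00FZ (Zariski's lemma), 02J7 (Jacobson), 02IZ (`dim 𝒪_{X,x}`).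
  [StacksProject]
-/

set_option linter.dupNamespace false -- single-problem summit: doubled namespace component is forced

noncomputable section

open CategoryTheory CategoryTheory.Limits AlgebraicGeometry Literature.AlgebraicGeometry.Resolution
open TopologicalSpace IsLocalRing

namespace Summit.ResolutionOfSingularities.ResolutionOfSingularities.Theorems

universe u

/-! ## Non-closed points of schemes locally of finite type over a field -/

/-- On an affine chart `U ∋ n` of a scheme locally of finite type over a field, the prime ideal
of a point `n` which is NOT closed is not maximal: a maximal prime is a closed point of
`Spec Γ(X, U)`, and closed points of the open `U` are closed in the Jacobson space `X`.
[cite: StacksProject, Tag 02J7] -/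
theorem not_isMaximal_primeIdealOf_of_not_isClosed {k : Type u} [Field k] {X : Scheme.{u}}
    (g : X ⟶ Spec (.of k)) [LocallyOfFiniteType g] {U : X.Opens} (hU : IsAffineOpen U)
    (n : X) (hnU : n ∈ U) (hn : ¬ IsClosed ({n} : Set X)) :
    ¬ (hU.primeIdealOf ⟨n, hnU⟩).asIdeal.IsMaximal := by
  haveI : JacobsonSpace X := LocallyOfFiniteType.jacobsonSpace g
  intro hm
  apply hn
  have h1 : IsClosed ({hU.primeIdealOf ⟨n, hnU⟩} : Set (PrimeSpectrum Γ(X, U))) :=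
    (PrimeSpectrum.isClosed_singleton_iff_isMaximal _).mpr hm
  have h2 : hU.primeIdealOf ⟨n, hnU⟩ ∈ hU.fromSpec ⁻¹' closedPoints X := by
    rw [hU.fromSpec.isOpenEmbedding.preimage_closedPoints]
    exact h1
  have hzn : hU.fromSpec (hU.primeIdealOf ⟨n, hnU⟩) = n := hU.fromSpec_primeIdealOf ⟨n, hnU⟩
  rw [← hzn]
  exact h2

/-- **The residue field at a NON-closed point of a scheme locally of finite type over a field
`k` is not finite over `k`** (for the `k`-structure `stalkAlgebra (overHom k N) n` of `𝒪_{N,n}`):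
on an affine chart `U ∋ n` with coordinate ring `A` and prime `𝔭`, the domain `A/𝔭` embeds
`k`-linearly into `𝒪_{N,n}/𝔪 = κ(𝔭)`; were the latter finite over `k`, so would be `A/𝔭`, which
would then be a field, i.e. `𝔭` maximal — but `n` is not closed. [cite: StacksProject, Tag 00FZ] -/
theorem not_finite_residue_stalk_overHom_of_not_isClosed (k : Type u) [Field k] (N : Scheme.{u})
    [N.Over (Spec (.of k))] [LocallyOfFiniteType (N ↘ Spec (.of k))] (n : N)
    (hn : ¬ IsClosed ({n} : Set N)) :
    letI := stalkAlgebra (overHom k N) n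
    ¬ Module.Finite k (N.presheaf.stalk n ⧸ maximalIdeal (N.presheaf.stalk n)) := by
  obtain ⟨U, hU, hnU, -⟩ :=
    exists_isAffineOpen_mem_and_subset (X := N) (x := n) (U := ⊤) (Opens.mem_top n)
  letI := sectionsAlgebra (overHom k N) U
  letI := stalkAlgebra (overHom k N) n
  letI algx : Algebra Γ(N, U) (N.presheaf.stalk n) := (N.presheaf.germ U n hnU).hom.toAlgebra
  haveI : IsScalarTower k Γ(N, U) (N.presheaf.stalk n) :=
    IsScalarTower.of_algebraMap_eq fun c =>
      (RingHom.congr_fun (germ_comp_sectionsHom (overHom k N) U n hnU) c).symm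
  set z := hU.primeIdealOf ⟨n, hnU⟩ with hz
  haveI : IsLocalization.AtPrime (N.presheaf.stalk n) z.asIdeal := hU.isLocalization_stalk ⟨n, hnU⟩
  have hmax : ¬ z.asIdeal.IsMaximal :=
    not_isMaximal_primeIdealOf_of_not_isClosed (N ↘ Spec (.of k)) hU n hnU hn
  intro hfin
  apply hmax
  -- the `k`-algebra map `A → 𝒪_{N,n} → 𝒪_{N,n}/𝔪` has kernel `𝔭`
  let S := N.presheaf.stalk n
  let φ : Γ(N, U) →ₐ[k] S ⧸ maximalIdeal S :=
    (Ideal.Quotient.mkₐ k (maximalIdeal S)).comp (IsScalarTower.toAlgHom k Γ(N, U) S)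
  have hunder : (maximalIdeal S).under Γ(N, U) = z.asIdeal :=
    IsLocalization.AtPrime.under_maximalIdeal S z.asIdeal
  have hker : ∀ a : Γ(N, U), φ a = 0 ↔ a ∈ z.asIdeal := by
    intro a
    change Ideal.Quotient.mk (maximalIdeal S) (algebraMap Γ(N, U) S a) = 0 ↔ _
    rw [Ideal.Quotient.eq_zero_iff_mem, ← hunder]
    rfl
  -- so `A/𝔭` embeds into the finite `k`-module `𝒪_{N,n}/𝔪`: it is finite over `k`
  let ψ : Γ(N, U) ⧸ z.asIdeal →ₐ[k] S ⧸ maximalIdeal S :=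
    Ideal.Quotient.liftₐ z.asIdeal φ fun a ha => (hker a).mpr ha
  have hψinj : Function.Injective ψ := by
    rw [injective_iff_map_eq_zero]
    intro b hb
    obtain ⟨a, rfl⟩ := Ideal.Quotient.mk_surjective b
    rw [Ideal.Quotient.eq_zero_iff_mem]
    exact (hker a).mp hb
  haveI : Module.Finite k (Γ(N, U) ⧸ z.asIdeal) :=
    Module.Finite.of_injective ψ.toLinearMap hψinj
  -- a domain finite over a field is a field
  haveI : Algebra.IsIntegral k (Γ(N, U) ⧸ z.asIdeal) := Algebra.IsIntegral.of_finite k _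
  rw [Ideal.Quotient.maximal_ideal_iff_isField_quotient]
  exact isField_of_isIntegral_of_isField' (R := k) (S := Γ(N, U) ⧸ z.asIdeal) (Field.toIsField k)

/-- Arithmetic in `ℕ∞` / `WithBot ℕ∞`: if `h + 1 ≤ d` for `h : ℕ∞` and a natural number `d`,
then `(h : WithBot ℕ∞) < d`. [folklore] -/
theorem withBot_coe_lt_of_add_one_le {h : ℕ∞} {d : ℕ} (hle : h + 1 ≤ (d : ℕ∞)) :
    (h : WithBot ℕ∞) < ((d : ℕ) : WithBot ℕ∞) := by
  have htop : h ≠ ⊤ := by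
    rintro rfl
    rw [top_add] at hle
    exact (ENat.coe_ne_top d) (top_le_iff.mp hle)
  have hlt : h < (d : ℕ∞) := (ENat.add_one_le_iff htop).mp hle
  rw [show ((d : ℕ) : WithBot ℕ∞) = (((d : ℕ) : ℕ∞) : WithBot ℕ∞) from rfl]
  exact WithBot.coe_lt_coe.mpr hlt

/-- **`dim 𝒪_{B,n} < d` at a NON-closed point `n` of an integral scheme `B` locally of finite
type over a field with `dim B ≤ d`.** On an affine chart `U ∋ n` with coordinate ring `A` (a
domain with `dim A = dim B`) and prime `𝔭` (not maximal, `n` not being closed):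
`dim 𝒪_{B,n} = ht 𝔭` (`IsLocalization.AtPrime.ringKrullDim_eq_height`), and for a maximal ideal
`𝔪 ⊋ 𝔭`, `ht 𝔭 + 1 ≤ ht 𝔪 ≤ dim A = dim B ≤ d`. [cite: StacksProject, Tag 02IZ] -/
theorem ringKrullDim_stalk_lt_of_not_isClosed {k : Type u} [Field k] {B : Scheme.{u}}
    [IsIntegral B] (g : B ⟶ Spec (.of k)) [LocallyOfFiniteType g] {d : ℕ}
    (hdimB : topologicalKrullDim B ≤ d) (n : B) (hn : ¬ IsClosed ({n} : Set B)) :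
    ringKrullDim (B.presheaf.stalk n) < (d : ℕ) := by
  obtain ⟨U, hU, hnU, -⟩ :=
    exists_isAffineOpen_mem_and_subset (X := B) (x := n) (U := ⊤) (Opens.mem_top n)
  set z := hU.primeIdealOf ⟨n, hnU⟩ with hz
  letI algx : Algebra Γ(B, U) (B.presheaf.stalk n) := (B.presheaf.germ U n hnU).hom.toAlgebra
  haveI : IsLocalization.AtPrime (B.presheaf.stalk n) z.asIdeal := hU.isLocalization_stalk ⟨n, hnU⟩
  have hmax : ¬ z.asIdeal.IsMaximal := not_isMaximal_primeIdealOf_of_not_isClosed g hU n hnU hn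
  -- `dim 𝒪_{B,n} = ht 𝔭`
  have h1 : ringKrullDim (B.presheaf.stalk n) = z.asIdeal.height :=
    IsLocalization.AtPrime.ringKrullDim_eq_height z.asIdeal (B.presheaf.stalk n)
  -- a maximal ideal strictly above `𝔭`
  obtain ⟨m, hm, hzm⟩ := Ideal.exists_le_maximal z.asIdeal z.2.ne_top
  have hlt : z.asIdeal < m := lt_of_le_of_ne hzm fun h => hmax (h ▸ hm)
  haveI := hm.isPrime
  have h2 : z.asIdeal.height + 1 ≤ m.height := Ideal.height_add_one_le_of_lt_of_isPrime hlt
  -- `ht 𝔪 ≤ dim A = dim B ≤ d`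
  have h3 : (m.height : WithBot ℕ∞) ≤ ringKrullDim Γ(B, U) :=
    Ideal.height_le_ringKrullDim_of_isPrime
  have h4 : ringKrullDim Γ(B, U) ≤ d := by
    rw [← topologicalKrullDim_eq_ringKrullDim_of_isAffineOpen g hU ⟨n, hnU⟩]
    exact hdimB
  have h5 : (m.height : WithBot ℕ∞) ≤ ((d : ℕ) : WithBot ℕ∞) := h3.trans h4
  have h6 : m.height ≤ (d : ℕ∞) := by
    rw [show ((d : ℕ) : WithBot ℕ∞) = (((d : ℕ) : ℕ∞) : WithBot ℕ∞) from rfl] at h5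
    exact WithBot.coe_le_coe.mp h5
  rw [h1]
  exact withBot_coe_lt_of_add_one_le (h2.trans h6)

end Summit.ResolutionOfSingularities.ResolutionOfSingularities.Theorems

end
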